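import Mathlib
import HarnessLib
import Summits.AtomisticToContinuum.FouriersLaw.Theses.JunctionLocality
import Summits.AtomisticToContinuum.FouriersLaw.Theorems.JunctionLocalityConductanceLowerBoundStubFisherSquare
import Summits.AtomisticToContinuum.FouriersLaw.Theorems.JunctionLocalitySuperadditiveResistanceKuboGauss
import Summits.AtomisticToContinuum.FouriersLaw.Theorems.JunctionLocalitySuperadditiveResistancePlainAdjoint
import Summits.AtomisticToContinuum.FouriersLaw.Theorems.JunctionLocalitySuperadditiveResistanceKuboReversal

/-!
# The certificate principle for the transmission-gradient floor, I: pairing an admissible pair with a field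
(crux stmt-AtomisticToContinuum-11749, line `ForecastSensitivitySketch`)

Helper file (`--supports stmt-AtomisticToContinuum-11749`, lead c5).  Setting: `pinnedChain ω₂ lam β γ` (`ω₂ > 0`,
`lam, β ≥ 0`, `γ > 0`), `T > 0`, `L ≥ 2`, `ρ = e^{−H/T}`, `S_B = bathOp L (bathWeight L) T`, `X_H = liouvilleOp`,
source `u = p_0² − T`.  An ADMISSIBLE PAIR `(φ, χ)` is a pair of `C²` functions with contact gradients in `L²(μ_T)`
and `γ S_B φ + X_H χ = −u` pointwise; a `σ`-FIELD (`σ = ±1`) is a `C² ∩ L²(μ_T)` solution `w` of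
`σ X_H w + γ S_B w = −u` — the left forward field `g` of the floor is the `1`-field, its momentum reversal
`g∘Θ` the `(−1)`-field (`Kubo.rev_pair`).

`certificate_pairing_field` — the exact pairing of the constraint with a `σ`-field, cutoff removed:

  `γT Σ_b ⟨∂_{p_b} w, ∂_{p_b} φ⟩_ρ − σ ⟨χ, u⟩_ρ + σ γT Σ_b ⟨∂_{p_b} χ, ∂_{p_b} w⟩_ρ = ⟨w, u⟩_ρ`   (`b ∈ {0, L−1}`),

obtained by integrating the constraint against `χ_n w ρ` (energy cutoffs `Kubo.chi`), moving `X_H` onto `w`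
(`integral_chi_liouville_antisymm`), substituting `X_H w = −σ(u + γ S_B w)`, integrating the two thermostat terms by
parts (`integral_chi_mul_bathOp`) and letting `n → ∞` (`∂_{p_b} w ∈ L²(μ_T)` by `Kubo.memLp_partialP`).  The
companion file `…CertificatePrinciple` adds the `σ = 1` and `σ = −1` instances and concludes the inf-side
variational principle `E_near(g) + E_far(g) ≤ cost(φ, χ)`.  No new definitions, no named facts, no sorry.
References: Bernardin–Olla 2011 §6; Komorowski–Landim–Olla 2012 §4.2 (variational formulas for non-reversible
resolvents); folklore.
-/

noncomputable section

open MeasureTheory Filter Topology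
open scoped ContDiff
open Literature.MathematicalPhysics.KineticTheory.HeatConduction
open Summit.AtomisticToContinuum.FouriersLaw.Theorems.SuperadditiveResistance.DeviceLiouville
  (kin kin_eq_sq continuous_kin liouvilleOp bathOp continuous_liouvilleOp continuous_bathOp
    generator_eq_liouvilleOp_add)
open Summit.AtomisticToContinuum.FouriersLaw.Theorems.SuperadditiveResistance.Kubo
  (chi contDiff_chi hasCompactSupport_chi tendsto_integral_chi_mul tendsto_integral_partialP_chi_mul
    integral_chi_mul_bathOp integral_chi_liouville_antisymm memLp_partialP
    integrable_mul_mul_gibbsDensity integrable_sq_mul_gibbsDensity memLp_momentum memLp_kinetic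
    rev rev_apply contDiff_rev memLp_rev rev_pair partialP_rev integral_rev_mul_gibbsDensity)

namespace Summit.AtomisticToContinuum.FouriersLaw.Cruxes.ConductanceLowerBound.ForecastSensitivity

variable {ω₂ lam β γ T : ℝ}


/-- The two bath weights are positive at the contacts. [folklore] -/
theorem bathWeight_pos_of_val {L : ℕ} {i : Fin L} (hi : i.val = 0 ∨ i.val = L - 1) :
    0 < OscillatorChain.bathWeight L i := by
  unfold OscillatorChain.bathWeight
  rcases hi with h | h
  · rw [if_pos h]; split_ifs <;> norm_num
  · rw [if_pos h]; split_ifs <;> norm_num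

/-- **Pairing an admissible pair with a `σ`-field (Lebesgue form).**  For `L ≥ 2`, `σ² = 1`, a `σ`-field `w`
(`w ∈ C² ∩ L²(μ_T)`, `σ X_H w + γ S_B w = −(p_0² − T)`) and an admissible pair `(φ, χ)` (`φ, χ ∈ C²`,
`∂_{p_b}φ, ∂_{p_b}χ ∈ L²(μ_T)` at `b = 0, L−1`, `χ ∈ L²(μ_T)`, `γ S_B φ + X_H χ = −(p_0² − T)`):
`γT Σ_b ∫ ∂_b w ∂_b φ ρ − σ ∫ χ (p_0² − T) ρ + σ γT Σ_b ∫ ∂_b χ ∂_b w ρ = ∫ w (p_0² − T) ρ`. [folklore] -/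
theorem certificate_pairing_field (hω : 0 < ω₂) (hl : 0 ≤ lam) (hβ : 0 ≤ β) (hγ : 0 < γ) (hT : 0 < T)
    {L : ℕ} (hL : 2 ≤ L) {σ : ℝ} (hσ : σ ^ 2 = 1) {w φ χ : PhaseSpace L → ℝ}
    (hw : ContDiff ℝ 2 w) (hw2 : MemLp w 2 ((pinnedChain ω₂ lam β γ).gibbsMeasure L T))
    (hweq : ∀ x, σ * liouvilleOp (pinnedChain ω₂ lam β γ) L w x + γ * bathOp L (OscillatorChain.bathWeight L) T w x =
      -(kin L 0 x - T))
    (hφ : ContDiff ℝ 2 φ) (hχ : ContDiff ℝ 2 χ)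
    (hφ0 : MemLp (partialP (⟨0, by omega⟩ : Fin L) φ) 2 ((pinnedChain ω₂ lam β γ).gibbsMeasure L T))
    (hφR : MemLp (partialP (⟨L - 1, by omega⟩ : Fin L) φ) 2 ((pinnedChain ω₂ lam β γ).gibbsMeasure L T))
    (hχ0 : MemLp (partialP (⟨0, by omega⟩ : Fin L) χ) 2 ((pinnedChain ω₂ lam β γ).gibbsMeasure L T))
    (hχR : MemLp (partialP (⟨L - 1, by omega⟩ : Fin L) χ) 2 ((pinnedChain ω₂ lam β γ).gibbsMeasure L T))
    (hχ2 : MemLp χ 2 ((pinnedChain ω₂ lam β γ).gibbsMeasure L T))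
    (hpair : ∀ x, γ * bathOp L (OscillatorChain.bathWeight L) T φ x +
      liouvilleOp (pinnedChain ω₂ lam β γ) L χ x = -(kin L 0 x - T)) :
    γ * T * ((∫ x, partialP (⟨0, by omega⟩ : Fin L) w x * partialP (⟨0, by omega⟩ : Fin L) φ x *
          (pinnedChain ω₂ lam β γ).gibbsDensity L T x) +
        ∫ x, partialP (⟨L - 1, by omega⟩ : Fin L) w x * partialP (⟨L - 1, by omega⟩ : Fin L) φ x *
          (pinnedChain ω₂ lam β γ).gibbsDensity L T x) -
      σ * (∫ x, χ x * (kin L 0 x - T) * (pinnedChain ω₂ lam β γ).gibbsDensity L T x) +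
      σ * (γ * T) * ((∫ x, partialP (⟨0, by omega⟩ : Fin L) χ x * partialP (⟨0, by omega⟩ : Fin L) w x *
          (pinnedChain ω₂ lam β γ).gibbsDensity L T x) +
        ∫ x, partialP (⟨L - 1, by omega⟩ : Fin L) χ x * partialP (⟨L - 1, by omega⟩ : Fin L) w x *
          (pinnedChain ω₂ lam β γ).gibbsDensity L T x) =
      ∫ x, w x * (kin L 0 x - T) * (pinnedChain ω₂ lam β γ).gibbsDensity L T x := by
  have hL0 : 0 < L := by omega
  have hL1 : L - 1 < L := by omega
  set B := OscillatorChain.bathWeight L with hB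
  set i0 : Fin L := ⟨0, hL0⟩ with hi0
  set iR : Fin L := ⟨L - 1, hL1⟩ with hiR
  have hTne : T ≠ 0 := hT.ne'
  have hBnn : ∀ i, 0 ≤ B i := bathWeight_nonneg L
  have hB0 : 0 < B i0 := bathWeight_pos_of_val (Or.inl rfl)
  have hBR : 0 < B iR := bathWeight_pos_of_val (Or.inr rfl)
  have hU := pinnedChain_contDiff_U ω₂ lam β γ (n := ∞)
  have hV := pinnedChain_contDiff_V ω₂ lam β γ (n := ∞)
  have hHs : ContDiff ℝ ∞ ((pinnedChain ω₂ lam β γ).hamiltonian L) := (pinnedChain ω₂ lam β γ).contDiff_hamiltonian hU hV L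
  have hρc : Continuous ((pinnedChain ω₂ lam β γ).gibbsDensity L T) := pinnedChain_continuous_gibbsDensity ω₂ lam β γ L T
  have hw1 : ContDiff ℝ 1 w := hw.of_le (by norm_cast)
  have hφ1 : ContDiff ℝ 1 φ := hφ.of_le (by norm_cast)
  have hχ1 : ContDiff ℝ 1 χ := hχ.of_le (by norm_cast)
  have hwc : Continuous w := hw.continuous
  have hχc : Continuous χ := hχ.continuous
  have hdwc : ∀ i, Continuous (partialP i w) := fun i => continuous_partialP hw1 one_ne_zero i
  have hdφc : ∀ i, Continuous (partialP i φ) := fun i => continuous_partialP hφ1 one_ne_zero i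
  have hdχc : ∀ i, Continuous (partialP i χ) := fun i => continuous_partialP hχ1 one_ne_zero i
  have hkc : Continuous (fun x : PhaseSpace L => kin L 0 x - T) := (continuous_kin 0).sub continuous_const
  have hχs : ∀ n, ContDiff ℝ ∞ (chi (pinnedChain ω₂ lam β γ) L n) := fun n => contDiff_chi hHs n
  have hχnc : ∀ n, Continuous (chi (pinnedChain ω₂ lam β γ) L n) := fun n => (hχs n).continuous
  have hχncs : ∀ n, HasCompactSupport (chi (pinnedChain ω₂ lam β γ) L n) := fun n => hasCompactSupport_chi hω hl hβ γ L n
  have hdχnc : ∀ n i, Continuous (partialP i (chi (pinnedChain ω₂ lam β γ) L n)) := fun n i =>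
    continuous_partialP ((hχs n).of_le (by norm_cast)) one_ne_zero i
  have hXχc : Continuous (liouvilleOp (pinnedChain ω₂ lam β γ) L χ) :=
    continuous_liouvilleOp (pinnedChain ω₂ lam β γ) (hU.of_le (by norm_cast)) (hV.of_le (by norm_cast)) hχ1
  have hXwc : Continuous (liouvilleOp (pinnedChain ω₂ lam β γ) L w) :=
    continuous_liouvilleOp (pinnedChain ω₂ lam β γ) (hU.of_le (by norm_cast)) (hV.of_le (by norm_cast)) hw1
  have hSφc : Continuous (bathOp L B T φ) := continuous_bathOp hφ B T
  have hSwc : Continuous (bathOp L B T w) := continuous_bathOp hw B T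
  -- L² data
  have hk2 : MemLp (fun x : PhaseSpace L => kin L 0 x - T) 2 ((pinnedChain ω₂ lam β γ).gibbsMeasure L T) :=
    (memLp_kinetic hω hl hβ L hT i0).ae_eq (ae_of_all _ fun x => by simp only [kin_eq_sq hL0]; rfl)
  have hdw2 : ∀ {i : Fin L}, 0 < B i → MemLp (partialP i w) 2 ((pinnedChain ω₂ lam β γ).gibbsMeasure L T) := fun {i} hi =>
    memLp_partialP hω hl hβ γ L hT B hBnn σ hγ hw hw2 hk2 hweq hi
  -- `X_H w = −σ (u + γ S_B w)` pointwise
  have hXw : ∀ x, liouvilleOp (pinnedChain ω₂ lam β γ) L w x = -σ * ((kin L 0 x - T) + γ * bathOp L B T w x) := by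
    intro x
    have h := hweq x
    have h2 : σ * (σ * liouvilleOp (pinnedChain ω₂ lam β γ) L w x + γ * bathOp L B T w x) = σ * (-(kin L 0 x - T)) := by rw [h]
    have e : σ * (σ * liouvilleOp (pinnedChain ω₂ lam β γ) L w x) = liouvilleOp (pinnedChain ω₂ lam β γ) L w x := by
      rw [← mul_assoc, ← sq, hσ, one_mul]
    linarith [h2, e]
  -- the identity at cutoff level n
  have hlevel : ∀ n : ℕ,
      γ * (-T * ∑ i, B i * ((∫ x, chi (pinnedChain ω₂ lam β γ) L n x * partialP i w x * partialP i φ x * (pinnedChain ω₂ lam β γ).gibbsDensity L T x) +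
        ∫ x, w x * partialP i (chi (pinnedChain ω₂ lam β γ) L n) x * partialP i φ x * (pinnedChain ω₂ lam β γ).gibbsDensity L T x)) +
      (σ * (∫ x, chi (pinnedChain ω₂ lam β γ) L n x * χ x * (kin L 0 x - T) * (pinnedChain ω₂ lam β γ).gibbsDensity L T x) +
        σ * γ * (-T * ∑ i, B i * ((∫ x, chi (pinnedChain ω₂ lam β γ) L n x * partialP i χ x * partialP i w x *
          (pinnedChain ω₂ lam β γ).gibbsDensity L T x) +
          ∫ x, χ x * partialP i (chi (pinnedChain ω₂ lam β γ) L n) x * partialP i w x * (pinnedChain ω₂ lam β γ).gibbsDensity L T x))) =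
      -∫ x, chi (pinnedChain ω₂ lam β γ) L n x * w x * (kin L 0 x - T) * (pinnedChain ω₂ lam β γ).gibbsDensity L T x := by
    intro n
    have hbath1 := integral_chi_mul_bathOp hω hl hβ γ L B hTne hw hφ n
    have hbath2 := integral_chi_mul_bathOp hω hl hβ γ L B hTne hχ hw n
    have hanti := integral_chi_liouville_antisymm hω hl hβ γ L hTne hw hχ n
    -- ∫ χ_n w X_Hχ ρ = σ ∫ χ_n χ u ρ + σ γ ∫ χ_n χ S_B w ρ
    have hIu : Integrable fun x => chi (pinnedChain ω₂ lam β γ) L n x * χ x * (kin L 0 x - T) * (pinnedChain ω₂ lam β γ).gibbsDensity L T x :=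
      Continuous.integrable_of_hasCompactSupport (by fun_prop) (((hχncs n).mul_right).mul_right.mul_right)
    have hIS : Integrable fun x => chi (pinnedChain ω₂ lam β γ) L n x * χ x * bathOp L B T w x * (pinnedChain ω₂ lam β γ).gibbsDensity L T x :=
      Continuous.integrable_of_hasCompactSupport (by fun_prop) (((hχncs n).mul_right).mul_right.mul_right)
    have hI2 : Integrable fun x => chi (pinnedChain ω₂ lam β γ) L n x * w x * liouvilleOp (pinnedChain ω₂ lam β γ) L χ x * (pinnedChain ω₂ lam β γ).gibbsDensity L T x :=
      Continuous.integrable_of_hasCompactSupport (by fun_prop) (((hχncs n).mul_right).mul_right.mul_right)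
    have hX : ∫ x, chi (pinnedChain ω₂ lam β γ) L n x * w x * liouvilleOp (pinnedChain ω₂ lam β γ) L χ x * (pinnedChain ω₂ lam β γ).gibbsDensity L T x =
        σ * (∫ x, chi (pinnedChain ω₂ lam β γ) L n x * χ x * (kin L 0 x - T) * (pinnedChain ω₂ lam β γ).gibbsDensity L T x) +
          σ * γ * ∫ x, chi (pinnedChain ω₂ lam β γ) L n x * χ x * bathOp L B T w x * (pinnedChain ω₂ lam β γ).gibbsDensity L T x := by
      have hJ : Integrable fun x => σ * (chi (pinnedChain ω₂ lam β γ) L n x * χ x * (kin L 0 x - T) * (pinnedChain ω₂ lam β γ).gibbsDensity L T x) +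
          σ * γ * (chi (pinnedChain ω₂ lam β γ) L n x * χ x * bathOp L B T w x * (pinnedChain ω₂ lam β γ).gibbsDensity L T x) :=
        (hIu.const_mul σ).add (hIS.const_mul (σ * γ))
      have s1 : ∫ x, σ * (chi (pinnedChain ω₂ lam β γ) L n x * χ x * (kin L 0 x - T) * (pinnedChain ω₂ lam β γ).gibbsDensity L T x) +
          σ * γ * (chi (pinnedChain ω₂ lam β γ) L n x * χ x * bathOp L B T w x * (pinnedChain ω₂ lam β γ).gibbsDensity L T x) =
          σ * (∫ x, chi (pinnedChain ω₂ lam β γ) L n x * χ x * (kin L 0 x - T) * (pinnedChain ω₂ lam β γ).gibbsDensity L T x) +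
            σ * γ * ∫ x, chi (pinnedChain ω₂ lam β γ) L n x * χ x * bathOp L B T w x * (pinnedChain ω₂ lam β γ).gibbsDensity L T x := by
        rw [integral_add (hIu.const_mul σ) (hIS.const_mul (σ * γ)), integral_const_mul, integral_const_mul]
      have s2 : ∫ x, chi (pinnedChain ω₂ lam β γ) L n x * w x * liouvilleOp (pinnedChain ω₂ lam β γ) L χ x * (pinnedChain ω₂ lam β γ).gibbsDensity L T x -
          (σ * (chi (pinnedChain ω₂ lam β γ) L n x * χ x * (kin L 0 x - T) * (pinnedChain ω₂ lam β γ).gibbsDensity L T x) +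
            σ * γ * (chi (pinnedChain ω₂ lam β γ) L n x * χ x * bathOp L B T w x * (pinnedChain ω₂ lam β γ).gibbsDensity L T x)) = 0 := by
        rw [← hanti]
        refine integral_congr_ae (ae_of_all _ fun x => ?_)
        dsimp only
        rw [hXw x]
        ring
      rw [integral_sub hI2 hJ, s1] at s2
      linarith
    -- integrate the constraint against χ_n w ρ
    have hI1 : Integrable fun x => chi (pinnedChain ω₂ lam β γ) L n x * w x * bathOp L B T φ x * (pinnedChain ω₂ lam β γ).gibbsDensity L T x :=
      Continuous.integrable_of_hasCompactSupport (by fun_prop) (((hχncs n).mul_right).mul_right.mul_right)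
    have hsum : γ * (∫ x, chi (pinnedChain ω₂ lam β γ) L n x * w x * bathOp L B T φ x * (pinnedChain ω₂ lam β γ).gibbsDensity L T x) +
        ∫ x, chi (pinnedChain ω₂ lam β γ) L n x * w x * liouvilleOp (pinnedChain ω₂ lam β γ) L χ x * (pinnedChain ω₂ lam β γ).gibbsDensity L T x =
        -∫ x, chi (pinnedChain ω₂ lam β γ) L n x * w x * (kin L 0 x - T) * (pinnedChain ω₂ lam β γ).gibbsDensity L T x := by
      rw [← integral_const_mul, ← integral_add (hI1.const_mul γ) hI2, ← integral_neg]
      refine integral_congr_ae (ae_of_all _ fun x => ?_)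
      have := hpair x
      calc γ * (chi (pinnedChain ω₂ lam β γ) L n x * w x * bathOp L B T φ x * (pinnedChain ω₂ lam β γ).gibbsDensity L T x) +
          chi (pinnedChain ω₂ lam β γ) L n x * w x * liouvilleOp (pinnedChain ω₂ lam β γ) L χ x * (pinnedChain ω₂ lam β γ).gibbsDensity L T x
          = chi (pinnedChain ω₂ lam β γ) L n x * w x * (γ * bathOp L B T φ x + liouvilleOp (pinnedChain ω₂ lam β γ) L χ x) * (pinnedChain ω₂ lam β γ).gibbsDensity L T x := by
            ring
        _ = chi (pinnedChain ω₂ lam β γ) L n x * w x * (-(kin L 0 x - T)) * (pinnedChain ω₂ lam β γ).gibbsDensity L T x := by rw [this]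
        _ = -(chi (pinnedChain ω₂ lam β γ) L n x * w x * (kin L 0 x - T) * (pinnedChain ω₂ lam β γ).gibbsDensity L T x) := by ring
    rw [hX, hbath1, hbath2] at hsum
    linarith [hsum]
  -- the two contact terms
  have hlevel' : ∀ n : ℕ,
      -(γ * T) * (((∫ x, chi (pinnedChain ω₂ lam β γ) L n x * partialP i0 w x * partialP i0 φ x * (pinnedChain ω₂ lam β γ).gibbsDensity L T x) +
          ∫ x, w x * partialP i0 (chi (pinnedChain ω₂ lam β γ) L n) x * partialP i0 φ x * (pinnedChain ω₂ lam β γ).gibbsDensity L T x) +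
        ((∫ x, chi (pinnedChain ω₂ lam β γ) L n x * partialP iR w x * partialP iR φ x * (pinnedChain ω₂ lam β γ).gibbsDensity L T x) +
          ∫ x, w x * partialP iR (chi (pinnedChain ω₂ lam β γ) L n) x * partialP iR φ x * (pinnedChain ω₂ lam β γ).gibbsDensity L T x)) +
      (σ * (∫ x, chi (pinnedChain ω₂ lam β γ) L n x * χ x * (kin L 0 x - T) * (pinnedChain ω₂ lam β γ).gibbsDensity L T x) +
        -(σ * (γ * T)) * (((∫ x, chi (pinnedChain ω₂ lam β γ) L n x * partialP i0 χ x * partialP i0 w x * (pinnedChain ω₂ lam β γ).gibbsDensity L T x) +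
          ∫ x, χ x * partialP i0 (chi (pinnedChain ω₂ lam β γ) L n) x * partialP i0 w x * (pinnedChain ω₂ lam β γ).gibbsDensity L T x) +
        ((∫ x, chi (pinnedChain ω₂ lam β γ) L n x * partialP iR χ x * partialP iR w x * (pinnedChain ω₂ lam β γ).gibbsDensity L T x) +
          ∫ x, χ x * partialP iR (chi (pinnedChain ω₂ lam β γ) L n) x * partialP iR w x * (pinnedChain ω₂ lam β γ).gibbsDensity L T x))) =
      -∫ x, chi (pinnedChain ω₂ lam β γ) L n x * w x * (kin L 0 x - T) * (pinnedChain ω₂ lam β γ).gibbsDensity L T x := by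
    intro n
    rw [← hlevel n, sum_bathWeight_mul' _ (b₀ := i0) (b₁ := iR) rfl rfl,
      sum_bathWeight_mul' _ (b₀ := i0) (b₁ := iR) rfl rfl]
    ring
  -- limits
  have hlimA : ∀ {i : Fin L} {a c : PhaseSpace L → ℝ}, Continuous a → Continuous c →
      MemLp a 2 ((pinnedChain ω₂ lam β γ).gibbsMeasure L T) → MemLp c 2 ((pinnedChain ω₂ lam β γ).gibbsMeasure L T) →
      Tendsto (fun n : ℕ => ∫ x, chi (pinnedChain ω₂ lam β γ) L n x * a x * c x * (pinnedChain ω₂ lam β γ).gibbsDensity L T x) atTop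
        (𝓝 (∫ x, a x * c x * (pinnedChain ω₂ lam β γ).gibbsDensity L T x)) := by
    intro i a c hac hcc ha hc
    have hF : Integrable fun x => a x * c x * (pinnedChain ω₂ lam β γ).gibbsDensity L T x :=
      integrable_mul_mul_gibbsDensity hω hl hβ γ L hT ha hc
    refine (tendsto_integral_chi_mul hω.le hl hβ γ L T (F := fun x => a x * c x) (by fun_prop) hF).congr
      fun n => ?_
    exact integral_congr_ae (ae_of_all _ fun x => by ring)
  have hlimB : ∀ {i : Fin L} {a c : PhaseSpace L → ℝ}, Continuous a → Continuous c →
      MemLp a 2 ((pinnedChain ω₂ lam β γ).gibbsMeasure L T) → MemLp c 2 ((pinnedChain ω₂ lam β γ).gibbsMeasure L T) →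
      Tendsto (fun n : ℕ => ∫ x, a x * partialP i (chi (pinnedChain ω₂ lam β γ) L n) x * c x * (pinnedChain ω₂ lam β γ).gibbsDensity L T x) atTop
        (𝓝 0) := by
    intro i a c hac hcc ha hc
    have hF : Integrable fun x => a x * c x * (pinnedChain ω₂ lam β γ).gibbsDensity L T x :=
      integrable_mul_mul_gibbsDensity hω hl hβ γ L hT ha hc
    refine (tendsto_integral_partialP_chi_mul hω hl hβ γ L T i (F := fun x => a x * c x) (by fun_prop)
      hF).congr fun n => ?_
    exact integral_congr_ae (ae_of_all _ fun x => by ring)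
  have hlimS : Tendsto (fun n : ℕ => ∫ x, chi (pinnedChain ω₂ lam β γ) L n x * w x * (kin L 0 x - T) * (pinnedChain ω₂ lam β γ).gibbsDensity L T x)
      atTop (𝓝 (∫ x, w x * (kin L 0 x - T) * (pinnedChain ω₂ lam β γ).gibbsDensity L T x)) :=
    hlimA (i := i0) hwc hkc hw2 hk2
  have hlimU : Tendsto (fun n : ℕ => ∫ x, chi (pinnedChain ω₂ lam β γ) L n x * χ x * (kin L 0 x - T) * (pinnedChain ω₂ lam β γ).gibbsDensity L T x)
      atTop (𝓝 (∫ x, χ x * (kin L 0 x - T) * (pinnedChain ω₂ lam β γ).gibbsDensity L T x)) :=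
    hlimA (i := i0) hχc hkc hχ2 hk2
  have hLHS := ((((hlimA (i := i0) (hdwc i0) (hdφc i0) (hdw2 hB0) hφ0).add
      (hlimB (i := i0) hwc (hdφc i0) hw2 hφ0)).add
      ((hlimA (i := iR) (hdwc iR) (hdφc iR) (hdw2 hBR) hφR).add
      (hlimB (i := iR) hwc (hdφc iR) hw2 hφR))).const_mul (-(γ * T))).add
    ((hlimU.const_mul σ).add
      ((((hlimA (i := i0) (hdχc i0) (hdwc i0) hχ0 (hdw2 hB0)).add
        (hlimB (i := i0) hχc (hdwc i0) hχ2 (hdw2 hB0))).add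
        ((hlimA (i := iR) (hdχc iR) (hdwc iR) hχR (hdw2 hBR)).add
        (hlimB (i := iR) hχc (hdwc iR) hχ2 (hdw2 hBR)))).const_mul (-(σ * (γ * T)))))
  have heq := tendsto_nhds_unique (hLHS.congr hlevel') hlimS.neg
  simp only [add_zero] at heq
  linarith

/-- Registered helper sub-goal `helper_certificatePairingField` of stub `stub_transmissionGradientFloor` (= `certificate_pairing_field`
in closed form; line ForecastSensitivitySketch, crux stmt-AtomisticToContinuum-11749). [folklore] -/
theorem helper_certificatePairingField : ∀ {ω₂ lam β γ T : ℝ}, 0 < ω₂ → 0 ≤ lam → 0 ≤ β → 0 < γ → 0 < T → ∀ {L : ℕ} (hL : 2 ≤ L) {σ : ℝ}, σ ^ 2 = 1 → ∀ {w φ χ : PhaseSpace L → ℝ}, ContDiff ℝ 2 w → MemLp w 2 ((pinnedChain ω₂ lam β γ).gibbsMeasure L T) → (∀ x, σ * liouvilleOp (pinnedChain ω₂ lam β γ) L w x + γ * bathOp L (OscillatorChain.bathWeight L) T w x = -(kin L 0 x - T)) → ContDiff ℝ 2 φ → ContDiff ℝ 2 χ → MemLp (partialP (⟨0, by omega⟩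 : Fin L) φ) 2 ((pinnedChain ω₂ lam β γ).gibbsMeasure L T) → MemLp (partialP (⟨L - 1, by omega⟩ : Fin L) φ) 2 ((pinnedChain ω₂ lam β γ).gibbsMeasure L T) → MemLp (partialP (⟨0, by omega⟩ : Fin L) χ) 2 ((pinnedChain ω₂ lam β γ).gibbsMeasure L T) → MemLp (partialP (⟨L - 1, by omega⟩ : Fin L) χ) 2 ((pinnedChain ω₂ lam β γ).gibbsMeasure L T) → MemLp χ 2 ((pinnedChain ω₂ lam β γ).gibbsMeasure L T) → (∀ x, γ * bathOp L (OscillatorChain.bathWeight L) T φ x + liouvilleOp (pinnedChain ω₂ lam β γ) L χ x = -(kin L 0 x - T)) → γ * T * ((∫ x, partialP (⟨0, by omega⟩ : Fin L) w x * partialP (⟨0, by omega⟩ : Fin L) φ x * (pinnedChain ω₂ lam β γ).gibbsDensity L T x) + ∫ x, partialP (⟨L - 1, by omega⟩ : Fin L) w x * partialP (⟨L - 1, by omega⟩ : Fin L) φ x * (pinnedChain ω₂ lam β γ).gibbsDensity L T x) - σ * (∫ x, χ x * (kin L 0 x - T) * (pinnedChain ω₂ lam β γ).gibbsDensity L T x)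 + σ * (γ * T) * ((∫ x, partialP (⟨0, by omega⟩ : Fin L) χ x * partialP (⟨0, by omega⟩ : Fin L) w x * (pinnedChain ω₂ lam β γ).gibbsDensity L T x) + ∫ x, partialP (⟨L - 1, by omega⟩ : Fin L) χ x * partialP (⟨L - 1, by omega⟩ : Fin L) w x * (pinnedChain ω₂ lam β γ).gibbsDensity L T x) = ∫ x, w x * (kin L 0 x - T) * (pinnedChain ω₂ lam β γ).gibbsDensity L T x :=
  @certificate_pairing_field

end Summit.AtomisticToContinuum.FouriersLaw.Cruxes.ConductanceLowerBound.ForecastSensitivity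

end
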